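import Literature.AnabelianGeometry.SemiGraphs.ArithDecompositionDataProofs
import Literature.AnabelianGeometry.SemiGraphs.ArithTemperedGroupOfOuterAction
import HarnessLib

/-!
# [SemiAnbd] Thm 5.4 (i) p. 66 — the design input `hest` (total arithmetic estrangement) is REFUTED at every
# SPLIT model with a node: a kernel obstruction complementing the NV certificate (proof-only)

Mochizuki, *Semi-graphs of anabelioids*, Publ. RIMS **42** (2006), §5: Def. 5.3 (i)/(ii) p. 65 (arithmetically
ample; arithmetically estranged edges; totally arithmetically estranged), Thm. 5.4 p. 66, Ex. 5.6 p. 67 (the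
`p`-adic situation where the hypothesis is met) [cite: MochizukiSemiAnbd2006, Def 5.3 p.65].

PROOF-ONLY file (cell abc-iut, layer L3, producer row T54-B, brick «T54 NV inputs: noSwitchBase / hest / hbot»,
L3-lead ruling α55, seat abc-iut-w6-d072).  The inhabitation side of the capstone's design inputs is
abc-iut-w6-d099's `ArithThm54DesignInputsNonVacuity.lean` (all six inputs at the trivial outer action over the
tree's EDGELESS Thm-3.7 witness; `hest` vacuous there) and `ArithNotAmpleBot.lean` (`hbot` ⟺ `Π_A` not
discrete); both are consumed by name, nothing is duplicated here.  THIS FILE adds the converse, a KERNEL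
OBSTRUCTION answering w6-d099's residual «a contentful certificate for `hest` needs a graph WITH AN EDGE»:

* for the TRIVIAL outer action `ρ' = 1` (`π₁^temp(𝒢) ⋊^out Π_A = Inn(π₁^temp(𝒢)) ×_{Out} Π_A`, the shape of
  every split / product toy `G × Π_A`) the pairs `(1, a)`, `a ∈ Π_A`, lie in the outer semi-direct product
  (`one_prod_mem_outerSemidirectProduct_one`), centralise `ι(π₁^temp(𝒢))`
  (`one_prod_commute_toOuterSemidirectProduct`), hence lie in EVERY vertex group and EVERY branch group of
  the produced decomposition data `decompositionDataOfChart Rc ι` (`one_prod_mem_arithVertGp`,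
  `one_prod_mem_arithBrGp`) and in every conjugate of a subgroup containing them (`one_prod_mem_conjSubgroup`);
* so every intersection `Π_b ∩ g Π_{b'} g⁻¹` meets every fibre of `aug` and is arithmetically AMPLE
  (`isArithAmple_brGp_inf_conjSubgroup_of_trivial`) — for ALL branches `b, b'` and ALL `g`;
* hence NO edge having a branch `b → v` next to a second branch `b' ≠ b` at `v` is arithmetically estranged
  (`not_isArithEstrangedEdge_of_trivial`), and **`hest` is FALSE at every split model whose semi-graph has a
  vertex carrying two distinct branches** (`not_isTotallyArithEstranged_of_trivial`).

Reading (no side taken): total arithmetic estrangement is a constraint on the arithmetic TWIST of the outer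
action between the branch groups at a node (Ex. 5.6); a contentful non-vacuity witness for `hest` therefore needs
a semi-graph of anabelioids with an edge AND a non-split outer action — neither a product toy nor an edgeless
witness can supply it.  The edgeless models where `hest` is vacuous are exactly the counter-shape where the
capstone's `hfaith` / `hcof` fail (abc-iut-w4-d085 `ArithLevelCofinality`).  No definition, no new named fact;
nothing here asserts or denies a hypothesis of Thm 5.4 for any genuine datum; nothing here bears on [IUTchIII]
Cor. 3.12; typed ≠ proved.
-/

namespace Literature.AnabelianGeometry.SemiGraphs

open CategoryTheory Topology
open scoped Pointwise

universe u v w w'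

/-! ### Arithmetic ampleness from fibrewise surjectivity -/

section Ample

variable {Gtp : Type u} [Group Gtp] [TopologicalSpace Gtp] {PA : Type v} [Group PA] [TopologicalSpace PA]

omit [TopologicalSpace Gtp] in
/-- A subgroup meeting every fibre of `aug` is arithmetically ample (its image is all of `Π_A`).
[cite: MochizukiSemiAnbd2006, Def 5.3 (i) p.65] -/
theorem isArithAmple_of_forall_exists (aug : Gtp →* PA) {K : Subgroup Gtp}
    (h : ∀ a : PA, ∃ e ∈ K, aug e = a) : IsArithAmple aug K := by
  have htop : K.map aug = ⊤ := by
    refine top_le_iff.mp fun a _ => ?_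
    obtain ⟨e, he, hea⟩ := h a
    exact ⟨e, he, hea⟩
  unfold IsArithAmple
  rw [htop, Subgroup.coe_top]
  exact isOpen_univ

end Ample

/-! ### `hest` at split models: the kernel obstruction -/

section Generic

/-- An element centralising a subgroup commensurates it (the commensurator `C_E(S)` of [SemiAnbd] §0,
«Topological Groups», contains the centraliser). [cite: MochizukiSemiAnbd2006, §0 p.5] -/
theorem mem_commensurator_of_forall_commute {E : Type v} [Group E] {S : Subgroup E} {x : E}
    (hx : ∀ s ∈ S, x * s = s * x) : x ∈ Subgroup.Commensurable.commensurator S := by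
  rw [Subgroup.Commensurable.commensurator_mem_iff]
  have hS : ConjAct.toConjAct x • S = S := by
    ext s
    rw [Subgroup.mem_smul_pointwise_iff_exists]
    constructor
    · rintro ⟨t, ht, rfl⟩
      rw [ConjAct.smul_def, ConjAct.ofConjAct_toConjAct, hx t ht, mul_inv_cancel_right]
      exact ht
    · intro hs
      refine ⟨s, hs, ?_⟩
      rw [ConjAct.smul_def, ConjAct.ofConjAct_toConjAct, hx s hs, mul_inv_cancel_right]
  simpa only [hS] using Subgroup.Commensurable.refl S

end Generic

namespace ProfiniteSemiGraph

open Literature.AnabelianGeometry.EtaleTheta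

variable {𝒢 : ProfiniteSemiGraph.{u}} (c : TemperedPiChart 𝒢) {PA : Type w} [Group PA]

/-- The pairs `(1, a)` lie in `π₁^temp(𝒢) ⋊^out Π_A` for the TRIVIAL outer action (`Out`-class of `1` is
`ρ'(a) = 1`). [cite: MochizukiSemiAnbd2006, §0 p.5] -/
theorem one_prod_mem_outerSemidirectProduct_one (a : PA) :
    (((1 : contMulAut c.G), a) : contMulAut c.G × PA) ∈ outerSemidirectProduct (1 : PA →* TopOut c.G) := by
  change TopOut.mk c.G 1 = (1 : PA →* TopOut c.G) a
  rw [map_one, MonoidHom.one_apply]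

/-- `(1, a)` commutes with `ι(g) = (conj g, 1)`. [cite: MochizukiSemiAnbd2006, §0 p.5] -/
theorem one_prod_commute_toOuterSemidirectProduct (a : PA) (g : c.G) :
    (⟨((1 : contMulAut c.G), a), one_prod_mem_outerSemidirectProduct_one c a⟩ :
        outerSemidirectProduct (1 : PA →* TopOut c.G)) * toOuterSemidirectProduct 1 g =
      toOuterSemidirectProduct 1 g *
        ⟨((1 : contMulAut c.G), a), one_prod_mem_outerSemidirectProduct_one c a⟩ := by
  apply Subtype.ext
  apply Prod.ext
  · change (1 : contMulAut c.G) * (toOuterSemidirectProduct (1 : PA →* TopOut c.G) g).1.1 =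
      (toOuterSemidirectProduct (1 : PA →* TopOut c.G) g).1.1 * 1
    rw [one_mul, mul_one]
  · change a * (toOuterSemidirectProduct (1 : PA →* TopOut c.G) g).1.2 =
      (toOuterSemidirectProduct (1 : PA →* TopOut c.G) g).1.2 * a
    rw [toOuterSemidirectProduct_snd, mul_one, one_mul]

/-- `(1, a)` commensurates `ι(H)` for every `H ≤ π₁^temp(𝒢)` (it centralises `ι(π₁^temp(𝒢))`).
[cite: MochizukiSemiAnbd2006, §5 p.65] -/
theorem one_prod_mem_commensurator_map (a : PA) (H : Subgroup c.G) :
    (⟨((1 : contMulAut c.G), a), one_prod_mem_outerSemidirectProduct_one c a⟩ :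
        outerSemidirectProduct (1 : PA →* TopOut c.G)) ∈
      Subgroup.Commensurable.commensurator (H.map (toOuterSemidirectProduct (1 : PA →* TopOut c.G))) := by
  refine mem_commensurator_of_forall_commute ?_
  rintro _ ⟨g, -, rfl⟩
  exact one_prod_commute_toOuterSemidirectProduct c a g

/-- **At the split model, `(1, a)` lies in every vertex group `Π^temp_{𝔊,v}` of the produced decomposition
data.** [cite: MochizukiSemiAnbd2006, §5 p.65] -/
theorem one_prod_mem_arithVertGp (Rc : ChartRepresentatives c) (a : PA) (v : 𝒢.graph.Vertex) :
    (⟨((1 : contMulAut c.G), a), one_prod_mem_outerSemidirectProduct_one c a⟩ :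
        outerSemidirectProduct (1 : PA →* TopOut c.G)) ∈
      arithVertGp Rc (toOuterSemidirectProduct (1 : PA →* TopOut c.G)) v :=
  one_prod_mem_commensurator_map c a (Rc.Hv v)

/-- **At the split model, `(1, a)` lies in every branch group `Π^temp_{𝔊,b}`.** [cite: MochizukiSemiAnbd2006, §5 p.65] -/
theorem one_prod_mem_arithBrGp (Rc : ChartRepresentatives c) (a : PA) (b : 𝒢.graph.Branch) :
    (⟨((1 : contMulAut c.G), a), one_prod_mem_outerSemidirectProduct_one c a⟩ :
        outerSemidirectProduct (1 : PA →* TopOut c.G)) ∈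
      arithBrGp Rc (toOuterSemidirectProduct (1 : PA →* TopOut c.G)) b := by
  unfold arithBrGp
  refine ⟨?_, one_prod_mem_commensurator_map c a (Rc.Hb b)⟩
  rcases hb : 𝒢.graph.abuts b with _ | v
  · simp only [Option.map_none, Option.getD_none]
    exact Subgroup.mem_top _
  · simp only [Option.map_some, Option.getD_some]
    exact one_prod_mem_arithVertGp c Rc a v

/-- **At the split model, every conjugate of a subgroup containing all `(1, a)` contains all `(1, a)`**:
`g · (1, a_g⁻¹ a a_g) · g⁻¹ = (1, a)` where `a_g = aug g`. [cite: MochizukiSemiAnbd2006, §0 p.5] -/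
theorem one_prod_mem_conjSubgroup {K : Subgroup (outerSemidirectProduct (1 : PA →* TopOut c.G))}
    (hK : ∀ a : PA, (⟨((1 : contMulAut c.G), a), one_prod_mem_outerSemidirectProduct_one c a⟩ :
        outerSemidirectProduct (1 : PA →* TopOut c.G)) ∈ K)
    (g : outerSemidirectProduct (1 : PA →* TopOut c.G)) (a : PA) :
    (⟨((1 : contMulAut c.G), a), one_prod_mem_outerSemidirectProduct_one c a⟩ :
        outerSemidirectProduct (1 : PA →* TopOut c.G)) ∈ conjSubgroup g K := by
  refine ⟨⟨((1 : contMulAut c.G), g.1.2⁻¹ * a * g.1.2), one_prod_mem_outerSemidirectProduct_one c _⟩,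
    hK _, ?_⟩
  change g * _ * g⁻¹ = _
  apply Subtype.ext
  apply Prod.ext
  · change g.1.1 * 1 * g.1.1⁻¹ = 1
    rw [mul_one, mul_inv_cancel]
  · change g.1.2 * (g.1.2⁻¹ * a * g.1.2) * g.1.2⁻¹ = a
    group

/-- **KERNEL OBSTRUCTION, core: at the split model every intersection `Π_b ∩ g Π_{b'} g⁻¹` of branch groups
of the produced decomposition data is arithmetically AMPLE** (it contains all `(1, a)`, so it surjects onto
`Π_A`). [cite: MochizukiSemiAnbd2006, Def 5.3 (i),(ii) p.65] -/
theorem isArithAmple_brGp_inf_conjSubgroup_of_trivial (Rc : ChartRepresentatives c) [TopologicalSpace PA]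
    [TopologicalSpace (outerSemidirectProduct (1 : PA →* TopOut c.G))]
    (b b' : 𝒢.graph.Branch) (g : outerSemidirectProduct (1 : PA →* TopOut c.G)) :
    IsArithAmple (outerSemidirectProductSnd (1 : PA →* TopOut c.G))
      (arithBrGp Rc (toOuterSemidirectProduct (1 : PA →* TopOut c.G)) b ⊓
        conjSubgroup g (arithBrGp Rc (toOuterSemidirectProduct (1 : PA →* TopOut c.G)) b')) := by
  refine isArithAmple_of_forall_exists _ fun a => ⟨⟨((1 : contMulAut c.G), a),
    one_prod_mem_outerSemidirectProduct_one c a⟩, ⟨one_prod_mem_arithBrGp c Rc a b,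
    one_prod_mem_conjSubgroup c (fun a' => one_prod_mem_arithBrGp c Rc a' b') g a⟩, rfl⟩

/-- **KERNEL OBSTRUCTION: at the split model NO edge with a branch `b → v` sitting next to a second branch
`b' ≠ b` at `v` is arithmetically estranged** (Def. 5.3 (ii), first clause, at `g = 1 ∈ Π^temp_{𝔊,v}`).
[cite: MochizukiSemiAnbd2006, Def 5.3 (ii) p.65] -/
theorem not_isArithEstrangedEdge_of_trivial (Rc : ChartRepresentatives c) [TopologicalSpace PA]
    [TopologicalSpace (outerSemidirectProduct (1 : PA →* TopOut c.G))]
    {b b' : 𝒢.graph.Branch} {v : 𝒢.graph.Vertex} (hb : 𝒢.graph.abuts b = some v)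
    (hb' : 𝒢.graph.abuts b' = some v) (hne : b' ≠ b) :
    ¬ IsArithEstrangedEdge (decompositionDataOfChart Rc (toOuterSemidirectProduct (1 : PA →* TopOut c.G)))
        (outerSemidirectProductSnd (1 : PA →* TopOut c.G)) (𝒢.graph.edgeOf b) := by
  intro hest
  have h1 := (hest b rfl v hb 1 (Subgroup.one_mem _)).1 b' hb' hne
  exact h1 (isArithAmple_brGp_inf_conjSubgroup_of_trivial c Rc b b' 1)

/-- **KERNEL OBSTRUCTION: `hest` is UNINHABITABLE at every split model whose semi-graph has a vertex carrying
two distinct branches** (a node or two edges at a vertex): the produced decomposition data of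
`π₁^temp(𝒢) ⋊^out Π_A` for the trivial outer action are NOT totally arithmetically estranged.
[cite: MochizukiSemiAnbd2006, Def 5.3 (ii) p.65] -/
theorem not_isTotallyArithEstranged_of_trivial (Rc : ChartRepresentatives c) [TopologicalSpace PA]
    [TopologicalSpace (outerSemidirectProduct (1 : PA →* TopOut c.G))]
    {b b' : 𝒢.graph.Branch} {v : 𝒢.graph.Vertex} (hb : 𝒢.graph.abuts b = some v)
    (hb' : 𝒢.graph.abuts b' = some v) (hne : b' ≠ b) :
    ¬ IsTotallyArithEstranged
        (decompositionDataOfChart Rc (toOuterSemidirectProduct (1 : PA →* TopOut c.G)))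
        (outerSemidirectProductSnd (1 : PA →* TopOut c.G)) :=
  fun h => not_isArithEstrangedEdge_of_trivial c Rc hb hb' hne (h (𝒢.graph.edgeOf b))

end ProfiniteSemiGraph

end Literature.AnabelianGeometry.SemiGraphs
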